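import Summits.Ventures.PercRepro.ExcessOneCompletionCases
import Summits.Ventures.PercRepro.ThetaTwoPairsV2

/-!
# Theorem W: every completion of a residue instance is `∅` or `univ`

A *residue instance* of Conjecture V (`ConjV`, ThetaTwoPairs.lean) is an MS-excess-1 family `F`
(`|F \\ F| = |F| + 1`) disjoint from its complement family, with a near-member `u ∉ F ∪ Fᶜ`
(every member `t` has its two agreement cells `t ∩ u`, `tᶜ ∩ uᶜ` or its two disagreement cells
`t \ u`, `u \ t` among the differences) such that neither `F ∪ {u}` nor `F ∪ {uᶜ}` is tight. A set
`v ∉ F` *completes* `F` if `F ∪ {v}` is tight; Conjecture V asserts that `∅` or `univ` completes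
every residue instance.

**Theorem W** (`completion_eq_empty_or_univ`): *every* completion of a residue instance is `∅` or
`univ`. Hence Conjecture V is equivalent to the bare existence of a completion, and a residue
instance has at most one completion (proofs/MINE1-theoremS.md, Addendum 12).

Proof. `G := F ∪ {v}` is tight with `G \\ G = F \\ F` (`diffs_insert_eq_of_tight`); `u` is
twin-closed (`twinClosed_of_cells`), `u, uᶜ ∉ G`, every member other than `v` is signable, the
members other than `v` contain no complementary pair, and the residue hypotheses give full
support and empty core (`exists_mem_of_residue`, `exists_notMem_of_residue`). The general
statement `completion_eq_empty_or_univ_of_tight` then reads, through Theorem S: the top member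
`Rstar G` is the exception `v` (`Rstar_eq_of_cells`), and `Rstar G` is `∅` or `univ`
(`Rstar_eq_empty_or_univ`, ExcessOneCompletionCases.lean).
-/

namespace PercRepro.MSTight

open Finset
open scoped FinsetFamily symmDiff

variable {α : Type*} [DecidableEq α] [Fintype α]

/-- **Theorem W, general form.** Let `G` be tight, `u` twin-closed with `u, uᶜ ∉ G`, and let
`v ∈ G` be such that every other member is A- or C*-signable for `u`, no other member has its
complement among the other members, and every element of the ground set lies in some member and
outside some member. Then `v = ∅` or `v = univ`. -/
theorem completion_eq_empty_or_univ_of_tight {G : Finset (Finset α)} (hT : Tight G)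
    {u v : Finset α} (hutc : TwinClosed G u) (hv : v ∈ G) (hu : u ∉ G)
    (huc : Finset.univ \ u ∉ G)
    (hsign : ∀ t ∈ G, t ≠ v → Cells (G \\ G) t u ∨ Cells (G \\ G) t (Finset.univ \ u))
    (hval : ∀ t ∈ G, t ≠ v → Finset.univ \ t ∈ G → Finset.univ \ t = v)
    (hsupp : ∀ a : α, ∃ t ∈ G, a ∈ t) (hcore : ∀ a : α, ∃ t ∈ G, a ∉ t) :
    v = ∅ ∨ v = Finset.univ := by
  obtain ⟨M, hM⟩ : ∃ M, M = Rstar G := ⟨_, rfl⟩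
  have hvM : v = M := Rstar_eq_of_cells hT hM hutc hv hu huc hsign
  have hvM' : M = v := hvM.symm
  subst hvM'
  exact Rstar_eq_empty_or_univ hT hM hutc hu huc hsign hval hsupp hcore

section Residue

variable {F : Finset (Finset α)}

/-- A near-member whose agreement cells at one member are differences is twin-closed. -/
theorem twinClosed_of_cells {u t : Finset α} (ht : t ∈ F) (h : Cells (F \\ F) t u) :
    TwinClosed F u := by
  obtain ⟨h1, h2⟩ := h
  have htc : TwinClosed F
      ((t ∩ u) ∪ (Finset.univ \ (t ∪ ((Finset.univ \ t) ∩ (Finset.univ \ u))))) :=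
    (twinClosed_of_mem_diffs h1).union
      ((twinClosed_univ F).sdiff ((twinClosed_of_mem ht).union (twinClosed_of_mem_diffs h2)))
  have e : (t ∩ u) ∪ (Finset.univ \ (t ∪ ((Finset.univ \ t) ∩ (Finset.univ \ u)))) = u := by
    ext a
    simp only [mem_union, mem_inter, mem_sdiff, mem_univ, true_and, not_or, not_and, not_not]
    tauto
  rwa [e] at htc

omit [DecidableEq α] [Fintype α] in
/-- Twin-closedness passes to superfamilies. -/
theorem TwinClosed.mono {G : Finset (Finset α)} (hFG : F ⊆ G) {u : Finset α}
    (h : TwinClosed F u) : TwinClosed G u :=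
  fun a b hab ha => h a b (fun t ht => hab t (hFG ht)) ha

omit [Fintype α] in
/-- No difference contains an element lying in every member. -/
theorem notMem_diffs_of_forall_mem {a : α} (ha : ∀ t ∈ F, a ∈ t) {x : Finset α}
    (hx : x ∈ F \\ F) : a ∉ x := by
  obtain ⟨t, -, s, hs, rfl⟩ := mem_diffs.1 hx
  exact fun h => (mem_sdiff.1 h).2 (ha s hs)

omit [Fintype α] in
/-- No difference contains an element lying in no member. -/
theorem notMem_diffs_of_forall_notMem {a : α} (ha : ∀ t ∈ F, a ∉ t) {x : Finset α}
    (hx : x ∈ F \\ F) : a ∉ x := by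
  obtain ⟨t, ht, s, -, rfl⟩ := mem_diffs.1 hx
  exact fun h => ha t ht (mem_sdiff.1 h).1

/-- The disagreement cells in the form used by `tight_insert_iff_of_excess_one`. -/
theorem cellsC_iff_sdiff {u t : Finset α} :
    Cells (F \\ F) t (Finset.univ \ u) ↔ u \ t ∈ F \\ F ∧ t \ u ∈ F \\ F := by
  dsimp only [Cells]
  have e1 : t ∩ (Finset.univ \ u) = t \ u := by
    ext a
    simp only [mem_inter, mem_sdiff, mem_univ, true_and]
  have e2 : (Finset.univ \ t) ∩ (Finset.univ \ (Finset.univ \ u)) = u \ t := by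
    ext a
    simp only [mem_inter, mem_sdiff, mem_univ, true_and, not_not]
    tauto
  rw [e1, e2]
  exact and_comm

/-- The agreement cells in the form used by `tight_insert_iff_of_excess_one` at `uᶜ`. -/
theorem cellsA_iff_sdiff {u t : Finset α} :
    Cells (F \\ F) t u ↔
      (Finset.univ \ u) \ t ∈ F \\ F ∧ t \ (Finset.univ \ u) ∈ F \\ F := by
  dsimp only [Cells]
  have e1 : t ∩ u = t \ (Finset.univ \ u) := by
    ext a
    simp only [mem_inter, mem_sdiff, mem_univ, true_and, not_not]
  have e2 : (Finset.univ \ t) ∩ (Finset.univ \ u) = (Finset.univ \ u) \ t := by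
    ext a
    simp only [mem_inter, mem_sdiff, mem_univ, true_and]
    tauto
  rw [e1, e2]
  exact and_comm

/-- In a residue instance some member is A-signable and not C*-signable. -/
theorem exists_cells_of_residue {σ : Finset α → Bool} {u : Finset α}
    (hex : (F \\ F).card = F.card + 1) (hu : u ∉ F)
    (hcells : ∀ t ∈ F, Cells (F \\ F) t (if σ t = true then u else Finset.univ \ u))
    (hnt : ¬ Tight (insert u F)) :
    ∃ t ∈ F, Cells (F \\ F) t u ∧ ¬ Cells (F \\ F) t (Finset.univ \ u) := by
  rw [tight_insert_iff_of_excess_one hex hu] at hnt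
  obtain ⟨t, ht, hbad⟩ : ∃ t ∈ F, ¬ (u \ t ∈ F \\ F ∧ t \ u ∈ F \\ F) := by
    by_contra h
    exact hnt fun t ht => by_contra fun h' => h ⟨t, ht, h'⟩
  have hnC : ¬ Cells (F \\ F) t (Finset.univ \ u) := by
    rw [cellsC_iff_sdiff]
    exact hbad
  refine ⟨t, ht, ?_, hnC⟩
  have := hcells t ht
  by_cases hσ : σ t = true
  · simpa [hσ] using this
  · exact absurd (by simpa [hσ] using this) hnC

/-- In a residue instance some member is C*-signable and not A-signable. -/
theorem exists_cells_compl_of_residue {σ : Finset α → Bool} {u : Finset α}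
    (hex : (F \\ F).card = F.card + 1) (huc : Finset.univ \ u ∉ F)
    (hcells : ∀ t ∈ F, Cells (F \\ F) t (if σ t = true then u else Finset.univ \ u))
    (hntc : ¬ Tight (insert (Finset.univ \ u) F)) :
    ∃ t ∈ F, Cells (F \\ F) t (Finset.univ \ u) ∧ ¬ Cells (F \\ F) t u := by
  rw [tight_insert_iff_of_excess_one hex huc] at hntc
  obtain ⟨t, ht, hbad⟩ :
      ∃ t ∈ F, ¬ ((Finset.univ \ u) \ t ∈ F \\ F ∧ t \ (Finset.univ \ u) ∈ F \\ F) := by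
    by_contra h
    exact hntc fun t ht => by_contra fun h' => h ⟨t, ht, h'⟩
  have hnA : ¬ Cells (F \\ F) t u := by
    rw [cellsA_iff_sdiff]
    exact hbad
  refine ⟨t, ht, ?_, hnA⟩
  have := hcells t ht
  by_cases hσ : σ t = true
  · exact absurd (by simpa [hσ] using this) hnA
  · simpa [hσ] using this

/-- A residue instance has full support: every element lies in some member. -/
theorem exists_mem_of_residue {σ : Finset α → Bool} {u : Finset α}
    (hex : (F \\ F).card = F.card + 1) (hu : u ∉ F) (huc : Finset.univ \ u ∉ F)
    (hcells : ∀ t ∈ F, Cells (F \\ F) t (if σ t = true then u else Finset.univ \ u))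
    (hnt : ¬ Tight (insert u F)) (hntc : ¬ Tight (insert (Finset.univ \ u) F)) (a : α) :
    ∃ t ∈ F, a ∈ t := by
  by_contra h
  have h' : ∀ t ∈ F, a ∉ t := fun t ht hat => h ⟨t, ht, hat⟩
  obtain ⟨tA, htA, hA, -⟩ := exists_cells_of_residue hex hu hcells hnt
  obtain ⟨tC, htC, hC, -⟩ := exists_cells_compl_of_residue hex huc hcells hntc
  by_cases hau : a ∈ u
  · -- the cell `tCᶜ ∩ u` contains `a`
    refine notMem_diffs_of_forall_notMem h' hC.2 ?_
    simp only [mem_inter, mem_sdiff, mem_univ, true_and, not_not]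
    exact ⟨h' tC htC, hau⟩
  · -- the cell `tAᶜ ∩ uᶜ` contains `a`
    refine notMem_diffs_of_forall_notMem h' hA.2 ?_
    simp only [mem_inter, mem_sdiff, mem_univ, true_and]
    exact ⟨h' tA htA, hau⟩

/-- A residue instance has empty core: every element lies outside some member. -/
theorem exists_notMem_of_residue {σ : Finset α → Bool} {u : Finset α}
    (hex : (F \\ F).card = F.card + 1) (hu : u ∉ F) (huc : Finset.univ \ u ∉ F)
    (hcells : ∀ t ∈ F, Cells (F \\ F) t (if σ t = true then u else Finset.univ \ u))
    (hnt : ¬ Tight (insert u F)) (hntc : ¬ Tight (insert (Finset.univ \ u) F)) (a : α) :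
    ∃ t ∈ F, a ∉ t := by
  by_contra h
  have h' : ∀ t ∈ F, a ∈ t := fun t ht => by_contra fun hat => h ⟨t, ht, hat⟩
  obtain ⟨tA, htA, hA, -⟩ := exists_cells_of_residue hex hu hcells hnt
  obtain ⟨tC, htC, hC, -⟩ := exists_cells_compl_of_residue hex huc hcells hntc
  by_cases hau : a ∈ u
  · -- the cell `tA ∩ u` contains `a`
    exact notMem_diffs_of_forall_mem h' hA.1 (mem_inter.2 ⟨h' tA htA, hau⟩)
  · -- the cell `tC ∩ uᶜ` contains `a`
    refine notMem_diffs_of_forall_mem h' hC.1 ?_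
    simp only [mem_inter, mem_sdiff, mem_univ, true_and]
    exact ⟨h' tC htC, hau⟩

omit [Fintype α] in
/-- Adjoining a completion does not change the difference family. -/
theorem diffs_insert_eq_of_tight {v : Finset α} (hex : (F \\ F).card = F.card + 1) (hvF : v ∉ F)
    (hv : Tight (insert v F)) : insert v F \\ insert v F = F \\ F := by
  symm
  apply eq_of_subset_of_card_le (diffs_subset (subset_insert _ _) (subset_insert _ _))
  rw [hv, card_insert_of_notMem hvF, hex]

/-- **Theorem W.** In a residue instance of Conjecture V, every completion (a set `v ∉ F` with
`F ∪ {v}` tight) is `∅` or `univ`. -/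
theorem completion_eq_empty_or_univ {σ : Finset α → Bool} {u : Finset α}
    (hval : Disjoint F (compls F)) (hex : (F \\ F).card = F.card + 1) (hu : u ∉ F)
    (huc : Finset.univ \ u ∉ F)
    (hcells : ∀ t ∈ F, Cells (F \\ F) t (if σ t = true then u else Finset.univ \ u))
    (hnt : ¬ Tight (insert u F)) (hntc : ¬ Tight (insert (Finset.univ \ u) F))
    {v : Finset α} (hvF : v ∉ F) (hv : Tight (insert v F)) :
    v = ∅ ∨ v = Finset.univ := by
  have hFG : F ⊆ insert v F := subset_insert _ _
  have hD : insert v F \\ insert v F = F \\ F := diffs_insert_eq_of_tight hex hvF hv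
  -- `u` is twin-closed
  obtain ⟨tA, htA, hA, -⟩ := exists_cells_of_residue hex hu hcells hnt
  have hutc : TwinClosed (insert v F) u := (twinClosed_of_cells htA hA).mono hFG
  -- `u, uᶜ ∉ F ∪ {v}`
  have huG : u ∉ insert v F := by
    intro h
    rcases mem_insert.1 h with rfl | h
    · exact hnt hv
    · exact hu h
  have hucG : Finset.univ \ u ∉ insert v F := by
    intro h
    rcases mem_insert.1 h with h' | h
    · apply hntc
      rw [h']
      exact hv
    · exact huc h
  have hmemF : ∀ t ∈ insert v F, t ≠ v → t ∈ F := fun t ht htv =>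
    (mem_insert.1 ht).resolve_left htv
  refine completion_eq_empty_or_univ_of_tight hv hutc (mem_insert_self v F) huG hucG ?_ ?_ ?_ ?_
  · intro t ht htv
    have h := hcells t (hmemF t ht htv)
    rw [hD]
    by_cases hσ : σ t = true
    · exact Or.inl (by simpa [hσ] using h)
    · exact Or.inr (by simpa [hσ] using h)
  · intro t ht htv hct
    by_contra hne
    have htF := hmemF t ht htv
    have hctF := hmemF _ hct hne
    exact Finset.disjoint_left.1 hval htF (mem_compls.2 hctF)
  · intro a
    obtain ⟨t, ht, hat⟩ := exists_mem_of_residue hex hu huc hcells hnt hntc a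
    exact ⟨t, hFG ht, hat⟩
  · intro a
    obtain ⟨t, ht, hat⟩ := exists_notMem_of_residue hex hu huc hcells hnt hntc a
    exact ⟨t, hFG ht, hat⟩

/-- `∅` and `univ` cannot both complete a nonempty family without complementary pairs: the
differences would contain `∅`, every member and every complement of a member. -/
theorem not_tight_insert_empty_and_univ (hval : Disjoint F (compls F))
    (hex : (F \\ F).card = F.card + 1) (h0 : (∅ : Finset α) ∉ F)
    (hU : (Finset.univ : Finset α) ∉ F) (h0t : Tight (insert ∅ F))
    (hUt : Tight (insert Finset.univ F)) : False := by
  have hne : F.Nonempty := by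
    by_contra hemp
    rw [not_nonempty_iff_eq_empty] at hemp
    subst hemp
    simp at hex
  have hmem : ∀ t ∈ F, t ∈ F \\ F := by
    intro t ht
    have h := ((tight_insert_iff_of_excess_one hex h0).1 h0t t ht).2
    rwa [Finset.sdiff_empty] at h
  have hcompl : ∀ t ∈ F, Finset.univ \ t ∈ F \\ F := fun t ht =>
    ((tight_insert_iff_of_excess_one hex hU).1 hUt t ht).1
  have h0D : (∅ : Finset α) ∈ F \\ F := by
    obtain ⟨t, ht⟩ := hne
    exact mem_diffs.2 ⟨t, ht, t, ht, Finset.sdiff_self t⟩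
  have hsub : insert ∅ (F ∪ compls F) ⊆ F \\ F := by
    intro x hx
    rcases mem_insert.1 hx with rfl | hx
    · exact h0D
    rcases mem_union.1 hx with hx | hx
    · exact hmem x hx
    · have h := hcompl _ (mem_compls.1 hx)
      rwa [Finset.sdiff_sdiff_eq_self (subset_univ x)] at h
  have h0n : (∅ : Finset α) ∉ F ∪ compls F := by
    intro h
    rcases mem_union.1 h with h | h
    · exact h0 h
    · have := mem_compls.1 h
      rw [Finset.sdiff_empty] at this
      exact hU this
  have hcard := card_le_card hsub
  rw [card_insert_of_notMem h0n, card_union_of_disjoint hval, card_compls, hex] at hcard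
  have : 0 < F.card := card_pos.2 hne
  omega

/-- **A residue instance has at most one completion.** -/
theorem completion_unique {σ : Finset α → Bool} {u : Finset α}
    (hval : Disjoint F (compls F)) (hex : (F \\ F).card = F.card + 1) (hu : u ∉ F)
    (huc : Finset.univ \ u ∉ F)
    (hcells : ∀ t ∈ F, Cells (F \\ F) t (if σ t = true then u else Finset.univ \ u))
    (hnt : ¬ Tight (insert u F)) (hntc : ¬ Tight (insert (Finset.univ \ u) F))
    {v w : Finset α} (hvF : v ∉ F) (hv : Tight (insert v F)) (hwF : w ∉ F)
    (hw : Tight (insert w F)) : v = w := by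
  rcases completion_eq_empty_or_univ hval hex hu huc hcells hnt hntc hvF hv with rfl | rfl <;>
  rcases completion_eq_empty_or_univ hval hex hu huc hcells hnt hntc hwF hw with rfl | rfl
  · rfl
  · exact (not_tight_insert_empty_and_univ hval hex hvF hwF hv hw).elim
  · exact (not_tight_insert_empty_and_univ hval hex hwF hvF hw hv).elim
  · rfl

end Residue

end PercRepro.MSTight
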